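import Literature.NumberTheory.Transcendental.NesterenkoElimination
import Literature.RingTheory.GradedAlgebra.HomogeneousAssociatedPrimes
import Mathlib.RingTheory.Localization.AtPrime.Basic
import Mathlib.RingTheory.Localization.Ideal
import Mathlib.RingTheory.Nakayama
import Mathlib.RingTheory.GradedAlgebra.Radical
import HarnessLib

/-!
# Towards LNM 1752 Ch. 3 Proposition 4.11, II: homogeneous primary ideals of prescribed exponent (symbolic powers)

`Literature/NumberTheory/Transcendental/NesterenkoSymbolicPowers.lean`. Second step of the discharge
of the named fact `NesterenkoPhilippon2001_ch3_prop_4_11` (Nesterenko–Philippon (eds.), LNM 1752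
(2001), Ch. 3 Prop. 4.11, the Bézout step). The unmixed ideal `J` of that proposition must realise
the intersection CYCLE `V(𝔭) · Q = ∑ e_𝔮 [V(𝔮)]` in Nesterenko's encoding, where the associated form
of an unmixed ideal is `∏ F_𝔮^{k_𝔮}` with `k_𝔮` the EXPONENT of the `𝔮`-primary component
(Prop. 4.4): one needs, for each minimal prime `𝔮` of `(𝔭, Q)` and each `e ≥ 1`, a HOMOGENEOUS
`𝔮`-primary ideal whose exponent (`Nesterenko.primaryExponent`, the least `k` with `𝔮ᵏ ⊆ ·`) is
exactly `e` (the radical `√(𝔭, Q)` — all exponents `1` — does not satisfy inequality 3) of Prop. 4.11,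
cf. the conic and its tangent). This file supplies them:

* `symbPow 𝔮 e = 𝔮^{(e)} = {x : s x ∈ 𝔮ᵉ for some s ∉ 𝔮}` — the symbolic power of a prime (any
  commutative ring): `𝔮ᵉ ≤ 𝔮^{(e)} ≤ 𝔮`, `√𝔮^{(e)} = 𝔮`, `𝔮^{(e)}` is `𝔮`-primary
  (`isPrimary_symbPow`), and in a Noetherian domain `𝔮^{e−1} ⊄ 𝔮^{(e)}` for `𝔮 ≠ 0`
  (`not_pow_pred_le_symbPow`: otherwise `𝔪^{e−1} = 𝔪ᵉ` in `R_𝔮`, and Nakayama), so its exponent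
  is `e`;
* graded rings (`ℕ`-graded, as in `Literature/RingTheory/GradedAlgebra/HomogeneousAssociatedPrimes.lean`):
  lowest homogeneous components of products and powers, **a homogeneous ideal which is primary
  with respect to homogeneous elements is primary** (`isPrimary_of_homogeneous`, Bruns–Herzog
  Lemma 1.5.6 / Zariski–Samuel II Ch. VII §2; proof: for `x y ∈ I`, `y ∉ √I`, the power
  `(y − y_low)^N` multiplies `x` into `I` and has a homogeneous lowest component outside `√I`, so
  the lowest-degree lemma `exists_pow_mul_mem_of_mul_mem` of the tree applies), hence **the
  homogeneous core of a primary ideal is primary** (`isPrimary_homogeneousCore`);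
* `exists_homogeneous_primary_exponent_eq` — for a non-zero homogeneous prime `𝔮 ⊂ ℚ[x₀, …, x_m]`
  and `e ≥ 1`, the homogeneous core `q` of `𝔮^{(e)}` is homogeneous, `𝔮`-primary, with
  `𝔮ᵉ ≤ q ≤ 𝔮` and `primaryExponent q = e`.

Proofs only (one auxiliary definition, `symbPow`; no named facts).

## References

* [NesterenkoPhilippon2001] LNM 1752 (2001), Ch. 3 §4, Prop. 4.4 (p. 38), Prop. 4.11 (pp. 40–41);
  Ch. 10 §4 (p. 175: "the exponent of 𝔟").
* W. Bruns, J. Herzog, *Cohen–Macaulay rings*, rev. ed. (1998), Lemma 1.5.6.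
* O. Zariski, P. Samuel, *Commutative Algebra* I, Ch. IV §12 (symbolic powers); II, Ch. VII §2.
-/

noncomputable section

open DirectSum

namespace Literature.NumberTheory.Transcendental

namespace Nesterenko

/-! ### Symbolic powers of a prime ideal -/

section SymbPow

variable {R : Type*} [CommRing R]

/-- The **symbolic power** `𝔮^{(e)} = {x : s x ∈ 𝔮ᵉ for some s ∉ 𝔮}` of a prime ideal `𝔮` (the
contraction of `𝔮ᵉ R_𝔮`). [cite: NesterenkoPhilippon2001, Ch. 3 Prop. 4.4 (p. 38): the exponents
`k_j` of the primary components] -/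
def symbPow (𝔮 : Ideal R) [h𝔮 : 𝔮.IsPrime] (e : ℕ) : Ideal R where
  carrier := {x | ∃ s ∉ 𝔮, s * x ∈ 𝔮 ^ e}
  zero_mem' := ⟨1, fun h => h𝔮.ne_top ((Ideal.eq_top_iff_one _).mpr h), by simp⟩
  add_mem' := by
    rintro x y ⟨s, hs, hsx⟩ ⟨t, ht, hty⟩
    refine ⟨s * t, fun h => (h𝔮.mem_or_mem h).elim hs ht, ?_⟩
    have e1 : s * t * (x + y) = t * (s * x) + s * (t * y) := by ring
    rw [e1]
    exact Ideal.add_mem _ (Ideal.mul_mem_left _ _ hsx) (Ideal.mul_mem_left _ _ hty)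
  smul_mem' := by
    rintro c x ⟨s, hs, hsx⟩
    refine ⟨s, hs, ?_⟩
    have e1 : s * (c • x) = c * (s * x) := by rw [smul_eq_mul]; ring
    rw [e1]
    exact Ideal.mul_mem_left _ _ hsx

variable {𝔮 : Ideal R} [h𝔮 : 𝔮.IsPrime]

/-- Membership in `𝔮^{(e)}`. [folklore] -/
theorem mem_symbPow_iff {e : ℕ} {x : R} : x ∈ symbPow 𝔮 e ↔ ∃ s ∉ 𝔮, s * x ∈ 𝔮 ^ e := Iff.rfl

/-- `𝔮ᵉ ≤ 𝔮^{(e)}`. [folklore] -/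
theorem pow_le_symbPow (e : ℕ) : 𝔮 ^ e ≤ symbPow 𝔮 e := fun x hx =>
  ⟨1, fun h => h𝔮.ne_top ((Ideal.eq_top_iff_one _).mpr h), by simpa using hx⟩

/-- `𝔮^{(e)} ≤ 𝔮` for `e ≥ 1`. [folklore] -/
theorem symbPow_le {e : ℕ} (he : 1 ≤ e) : symbPow 𝔮 e ≤ 𝔮 := by
  rintro x ⟨s, hs, hsx⟩
  have h1 : s * x ∈ 𝔮 := Ideal.pow_le_self (by omega) hsx
  exact (h𝔮.mem_or_mem h1).resolve_left hs

/-- `𝔮^{(e)}` is proper. [folklore] -/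
theorem symbPow_ne_top {e : ℕ} (he : 1 ≤ e) : symbPow 𝔮 e ≠ ⊤ :=
  fun h => h𝔮.ne_top (top_le_iff.mp (h ▸ symbPow_le he))

/-- `√𝔮^{(e)} = 𝔮` for `e ≥ 1`. [folklore] -/
theorem radical_symbPow {e : ℕ} (he : 1 ≤ e) : (symbPow 𝔮 e).radical = 𝔮 := by
  refine le_antisymm ?_ ?_
  · exact (Ideal.radical_mono (symbPow_le he)).trans h𝔮.radical.le
  · intro x hx
    exact ⟨e, pow_le_symbPow e (Ideal.pow_mem_pow hx e)⟩

/-- **`𝔮^{(e)}` is `𝔮`-primary** (`e ≥ 1`). [folklore] -/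
theorem isPrimary_symbPow {e : ℕ} (he : 1 ≤ e) : (symbPow 𝔮 e).IsPrimary := by
  rw [Ideal.isPrimary_iff]
  refine ⟨symbPow_ne_top he, fun {x y} hxy => ?_⟩
  rw [radical_symbPow he]
  by_cases hy : y ∈ 𝔮
  · exact Or.inr hy
  · left
    obtain ⟨s, hs, hsxy⟩ := hxy
    refine ⟨s * y, fun h => (h𝔮.mem_or_mem h).elim hs hy, ?_⟩
    have e1 : s * y * x = s * (x * y) := by ring
    rwa [e1]

/-- The image of `𝔮^{(e)}` in `R_𝔮` lies in `𝔪ᵉ`, `𝔪 = 𝔮 R_𝔮`. [folklore] -/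
theorem algebraMap_mem_maximalIdeal_pow_of_mem_symbPow {e : ℕ} {x : R} (hx : x ∈ symbPow 𝔮 e) :
    algebraMap R (Localization.AtPrime 𝔮) x ∈
      IsLocalRing.maximalIdeal (Localization.AtPrime 𝔮) ^ e := by
  obtain ⟨s, hs, hsx⟩ := hx
  have hunit : IsUnit (algebraMap R (Localization.AtPrime 𝔮) s) :=
    IsLocalization.map_units _ (⟨s, hs⟩ : 𝔮.primeCompl)
  rw [← Ideal.unit_mul_mem_iff_mem _ hunit, ← map_mul, ← Localization.AtPrime.map_eq_maximalIdeal,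
    ← Ideal.map_pow]
  exact Ideal.mem_map_of_mem _ hsx

/-- **The exponent of `𝔮^{(e)}` is `e`**: in a Noetherian domain, for a non-zero prime `𝔮` and
`e ≥ 1`, `𝔮^{e−1} ⊄ 𝔮^{(e)}` — otherwise `𝔪^{e−1} = 𝔪ᵉ = 𝔪 · 𝔪^{e−1}` in the local ring `R_𝔮`,
whence `𝔪^{e−1} = 0` by Nakayama and `𝔮 = 0`. [folklore] -/
theorem not_pow_pred_le_symbPow [IsNoetherianRing R] [IsDomain R] (h0 : 𝔮 ≠ ⊥) {e : ℕ}
    (he : 1 ≤ e) : ¬ 𝔮 ^ (e - 1) ≤ symbPow 𝔮 e := by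
  intro hle
  set S := Localization.AtPrime 𝔮 with hS
  set 𝔪 : Ideal S := IsLocalRing.maximalIdeal S with h𝔪
  -- `𝔪^{e-1} ≤ 𝔪^e`
  have hpow : 𝔪 ^ (e - 1) ≤ 𝔪 ^ e := by
    have hmap : 𝔪 ^ (e - 1) = (𝔮 ^ (e - 1)).map (algebraMap R S) := by
      rw [Ideal.map_pow, Localization.AtPrime.map_eq_maximalIdeal]
    rw [hmap, Ideal.map_le_iff_le_comap]
    intro x hx
    exact algebraMap_mem_maximalIdeal_pow_of_mem_symbPow (hle hx)
  -- Nakayama: `𝔪^{e-1} = ⊥`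
  have hbot : 𝔪 ^ (e - 1) = ⊥ := by
    refine Submodule.eq_bot_of_le_smul_of_le_jacobson_bot 𝔪 (𝔪 ^ (e - 1)) (IsNoetherian.noetherian _)
      ?_ (IsLocalRing.maximalIdeal_le_jacobson _)
    change 𝔪 ^ (e - 1) ≤ 𝔪 * 𝔪 ^ (e - 1)
    rw [← pow_succ', Nat.sub_add_cancel he]
    exact hpow
  -- hence `𝔪 = ⊥` and `𝔮 = ⊥`
  have h𝔪bot : 𝔪 = ⊥ := by
    rcases Nat.eq_zero_or_pos (e - 1) with h | h
    · rw [h, pow_zero, Ideal.one_eq_top] at hbot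
      exact absurd hbot top_ne_bot
    · have h' : 𝔪 ^ (e - 1) = 0 := by rw [Ideal.zero_eq_bot]; exact hbot
      have h'' := (pow_eq_zero_iff (by omega)).mp h'
      rwa [Ideal.zero_eq_bot] at h''
  apply h0
  have hunder : 𝔪.under R = 𝔮 := by rw [h𝔪]; exact Localization.AtPrime.under_maximalIdeal
  rw [← hunder, Ideal.under_def, h𝔪bot,
    Ideal.comap_bot_of_injective _ (IsLocalization.injective S 𝔮.primeCompl_le_nonZeroDivisors)]

end SymbPow

/-! ### Graded rings: lowest components, homogeneously primary ideals -/

section Graded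

variable {σ A : Type*} [CommRing A] [SetLike σ A] [AddSubgroupClass σ A]
  (𝒜 : ℕ → σ) [GradedRing 𝒜]

/-- Lowest homogeneous components of a product: if the components of `z` below `p` and of `w`
below `q` vanish, then those of `z w` below `p + q` vanish and `(z w)_{p+q} = z_p w_q`. [folklore] -/
theorem decompose_mul_lowest {z w : A} {p q : ℕ} (hz : ∀ i, i < p → (decompose 𝒜 z i : A) = 0)
    (hw : ∀ j, j < q → (decompose 𝒜 w j : A) = 0) :
    (∀ n, n < p + q → (decompose 𝒜 (z * w) n : A) = 0) ∧
      (decompose 𝒜 (z * w) (p + q) : A) = decompose 𝒜 z p * decompose 𝒜 w q := by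
  classical
  have hexp : ∀ n, (decompose 𝒜 (z * w) n : A) =
      ∑ ij ∈ Finset.antidiagonal n, (decompose 𝒜 z ij.1 : A) * decompose 𝒜 w ij.2 := fun n => by
    rw [decompose_mul, DirectSum.coe_mul_apply_eq_sum_antidiagonal]
  refine ⟨fun n hn => ?_, ?_⟩
  · rw [hexp]
    refine Finset.sum_eq_zero fun ij hij => ?_
    rw [Finset.mem_antidiagonal] at hij
    rcases lt_or_ge ij.1 p with h1 | h1
    · rw [hz _ h1, zero_mul]
    · rw [hw _ (by omega), mul_zero]
  · rw [hexp, Finset.sum_eq_single (p, q)]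
    · rintro ⟨i, j⟩ hij hne
      rw [Finset.mem_antidiagonal] at hij
      rcases lt_or_ge i p with h1 | h1
      · rw [hz _ h1, zero_mul]
      · have hj : j < q := by
          rcases lt_or_ge j q with h2 | h2
          · exact h2
          · exfalso
            apply hne
            simp only at hij
            have hi : i = p := by omega
            have hj' : j = q := by omega
            rw [hi, hj']
        rw [hw _ hj, mul_zero]
    · intro h
      exact (h (Finset.mem_antidiagonal.mpr rfl)).elim

/-- Lowest homogeneous component of a power: `(z^N)_{N p} = (z_p)^N` and the components below
`N p` vanish, when those of `z` below `p` do. [folklore] -/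
theorem decompose_pow_lowest {z : A} {p : ℕ} (hz : ∀ i, i < p → (decompose 𝒜 z i : A) = 0)
    (N : ℕ) :
    (∀ n, n < N * p → (decompose 𝒜 (z ^ N) n : A) = 0) ∧
      (decompose 𝒜 (z ^ N) (N * p) : A) = (decompose 𝒜 z p : A) ^ N := by
  induction N with
  | zero =>
    refine ⟨fun n hn => absurd hn (by simp), ?_⟩
    rw [pow_zero, pow_zero, zero_mul]
    exact decompose_of_mem_same 𝒜 SetLike.GradedOne.one_mem
  | succ N ih =>
    obtain ⟨h1, h2⟩ := decompose_mul_lowest 𝒜 ih.1 hz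
    refine ⟨fun n hn => ?_, ?_⟩
    · rw [pow_succ]
      exact h1 n (by rw [Nat.succ_mul] at hn; exact hn)
    · rw [pow_succ, pow_succ, Nat.succ_mul, h2, ih.2]

variable {𝒜}

/-- **A homogeneous ideal that is primary with respect to homogeneous elements is primary**
(Bruns–Herzog, Lemma 1.5.6): if `I ≠ (1)` is homogeneous and `a b ∈ I ⇒ a ∈ I ∨ b ∈ √I` for all
HOMOGENEOUS `a, b`, then `I` is primary. [cite: BrunsHerzog1998, Lemma 1.5.6] -/
theorem isPrimary_of_homogeneous {I : Ideal A} (hI : I.IsHomogeneous 𝒜) (hne : I ≠ ⊤)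
    (h : ∀ {a b : A}, SetLike.IsHomogeneousElem 𝒜 a → SetLike.IsHomogeneousElem 𝒜 b →
      a * b ∈ I → a ∈ I ∨ b ∈ I.radical) :
    I.IsPrimary := by
  classical
  -- the radical `P` is a homogeneous prime
  have hPhom : I.radical.IsHomogeneous 𝒜 := hI.radical
  have hP : I.radical.IsPrime := by
    refine hPhom.isPrime_of_homogeneous_mem_or_mem (Ideal.radical_eq_top.not.mpr hne) ?_
    rintro a b ⟨i, hi⟩ ⟨j, hj⟩ ⟨n, hn⟩
    rw [mul_pow] at hn
    rcases h ⟨n • i, SetLike.pow_mem_graded n hi⟩ ⟨n • j, SetLike.pow_mem_graded n hj⟩ hn with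
      ha | hb
    · exact Or.inl ⟨n, ha⟩
    · exact Or.inr (Ideal.mem_radical_of_pow_mem hb)
  -- a homogeneous multiplier outside `P` can be cancelled
  have hcancel : ∀ {t x : A} {d : ℕ}, t ∈ 𝒜 d → t ∉ I.radical → t * x ∈ I → x ∈ I := by
    intro t x d ht htP htx
    rw [← sum_support_decompose 𝒜 x]
    refine Ideal.sum_mem _ fun i _ => ?_
    have hi : t * (decompose 𝒜 x i : A) ∈ I := by
      have := hI (d + i) htx
      rwa [coe_decompose_mul_of_left_mem_of_le 𝒜 ht (Nat.le_add_right d i),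
        Nat.add_sub_cancel_left] at this
    rcases h ⟨i, (decompose 𝒜 x i).2⟩ ⟨d, ht⟩ (by rwa [mul_comm] at hi) with hx | ht'
    · exact hx
    · exact absurd ht' htP
  rw [Ideal.isPrimary_iff]
  refine ⟨hne, fun {x y} hxy => ?_⟩
  by_cases hyP : y ∈ I.radical
  · exact Or.inr hyP
  left
  -- the lowest component `c` of `y` outside `P`, of degree `j₀`
  set S : Finset ℕ := (decompose 𝒜 y).support.filter fun j => (decompose 𝒜 y j : A) ∉ I.radical
    with hS
  have hSne : S.Nonempty := by
    rw [hS, Finset.filter_nonempty_iff]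
    by_contra hall
    push Not at hall
    apply hyP
    rw [← sum_support_decompose 𝒜 y]
    exact Ideal.sum_mem _ fun j hj => hall j hj
  set j₀ : ℕ := S.min' hSne with hj₀
  have hj₀S : j₀ ∈ S := Finset.min'_mem S hSne
  have hc : (decompose 𝒜 y j₀ : A) ∉ I.radical := (Finset.mem_filter.mp hj₀S).2
  have hbelow : ∀ j, j < j₀ → (decompose 𝒜 y j : A) ∈ I.radical := by
    intro j hj
    by_contra hjP
    have hjS : j ∈ S := by
      rw [hS, Finset.mem_filter, DFinsupp.mem_support_iff]
      refine ⟨fun h0 => hjP ?_, hjP⟩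
      rw [h0]; exact Submodule.zero_mem _
    exact absurd (Finset.min'_le S j hjS) (by rw [← hj₀]; omega)
  -- `y_low = ∑_{j < j₀} y_j ∈ P`, `y'' = y − y_low`
  set ylow : A := ∑ j ∈ (decompose 𝒜 y).support.filter (· < j₀), (decompose 𝒜 y j : A) with hylow
  have hylowP : ylow ∈ I.radical := Ideal.sum_mem _ fun j hj => hbelow j (Finset.mem_filter.mp hj).2
  obtain ⟨N, hN⟩ := hylowP
  set y'' : A := y - ylow with hy''
  -- components of `y''`: zero below `j₀`, `y_{j₀}` at `j₀`
  -- components of `ylow`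
  have hproj : ∀ i, (decompose 𝒜 ylow i : A) =
      if i ∈ (decompose 𝒜 y).support.filter (· < j₀) then (decompose 𝒜 y i : A) else 0 := by
    intro i
    rw [← GradedRing.proj_apply, hylow, map_sum]
    have hterm : ∀ j, GradedRing.proj 𝒜 i (decompose 𝒜 y j : A) =
        if j = i then (decompose 𝒜 y j : A) else 0 := by
      intro j
      rw [GradedRing.proj_apply]
      split_ifs with hji
      · subst hji
        exact decompose_of_mem_same 𝒜 (decompose 𝒜 y j).2
      · exact decompose_of_mem_ne 𝒜 (decompose 𝒜 y j).2 hji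
    simp_rw [hterm]
    rw [Finset.sum_ite_eq']
  have hy''low : ∀ i, i < j₀ → (decompose 𝒜 y'' i : A) = 0 := by
    intro i hi
    rw [hy'', Literature.RingTheory.GradedAlgebra.coe_decompose_sub, hproj]
    split_ifs with hi'
    · exact sub_self _
    · rw [Finset.mem_filter, not_and'] at hi'
      have h0 : (decompose 𝒜 y) i = 0 := DFinsupp.notMem_support_iff.mp (hi' hi)
      rw [h0, sub_zero]
      rfl
  have hy''j₀ : (decompose 𝒜 y'' j₀ : A) = decompose 𝒜 y j₀ := by
    rw [hy'', Literature.RingTheory.GradedAlgebra.coe_decompose_sub, hproj, if_neg, sub_zero]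
    rw [Finset.mem_filter]
    exact fun h => lt_irrefl _ h.2
  -- `a = y''^N` multiplies `x` into `I`
  obtain ⟨B, hB⟩ : ∃ B : A, y'' ^ N = y * B + (-ylow) ^ N := by
    obtain ⟨B, hB⟩ := sub_dvd_pow_sub_pow y'' (-ylow) N
    refine ⟨B, ?_⟩
    have e1 : y'' - -ylow = y := by rw [hy'']; ring
    rw [e1] at hB
    rw [← hB]; ring
  have hax : y'' ^ N * x ∈ I := by
    rw [hB, add_mul, mul_comm y B, mul_assoc, neg_pow, mul_assoc]
    refine Ideal.add_mem _ (Ideal.mul_mem_left _ _ (by rwa [mul_comm] at hxy))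
      (Ideal.mul_mem_left _ _ (Ideal.mul_mem_right _ _ hN))
  -- its lowest component is `c^N`, homogeneous of degree `N j₀`, outside `P`
  obtain ⟨hlow, htop⟩ := decompose_pow_lowest 𝒜 hy''low N
  rw [hy''j₀] at htop
  have hcN : ((decompose 𝒜 y j₀ : A)) ^ N ∈ 𝒜 (N * j₀) := by
    have h1 := SetLike.pow_mem_graded N (decompose 𝒜 y j₀).2
    rwa [smul_eq_mul] at h1
  obtain ⟨k, hk⟩ := Literature.RingTheory.GradedAlgebra.exists_pow_mul_mem_of_mul_mem 𝒜 hI hcN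
    hlow htop hax
  have hcNk : (((decompose 𝒜 y j₀ : A)) ^ N) ^ k ∈ 𝒜 (k * (N * j₀)) := by
    have h1 := SetLike.pow_mem_graded k hcN
    rwa [smul_eq_mul] at h1
  refine hcancel hcNk ?_ hk
  intro hmem
  apply hc
  rw [← pow_mul] at hmem
  exact hP.mem_of_pow_mem _ hmem

/-- **The homogeneous core of a primary ideal is primary.** [cite: BrunsHerzog1998, Lemma 1.5.6] -/
theorem isPrimary_homogeneousCore {Q : Ideal A} (hQ : Q.IsPrimary) :
    (Q.homogeneousCore 𝒜).toIdeal.IsPrimary := by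
  have hle : (Q.homogeneousCore 𝒜).toIdeal ≤ Q := Ideal.toIdeal_homogeneousCore_le _ _
  refine isPrimary_of_homogeneous (Q.homogeneousCore 𝒜).isHomogeneous
    (fun h => hQ.ne_top (top_le_iff.mp (h ▸ hle))) ?_
  intro a b ha hb hab
  rcases Ideal.isPrimary_iff.mp hQ |>.2 (hle hab) with haQ | hbQ
  · exact Or.inl (Ideal.mem_homogeneousCore_of_homogeneous_of_mem ha haQ)
  · right
    obtain ⟨n, hn⟩ := hbQ
    obtain ⟨j, hj⟩ := hb
    exact ⟨n, Ideal.mem_homogeneousCore_of_homogeneous_of_mem ⟨n • j, SetLike.pow_mem_graded n hj⟩ hn⟩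

/-- Powers of a homogeneous ideal are homogeneous. [folklore] -/
theorem isHomogeneous_pow {I : Ideal A} (hI : I.IsHomogeneous 𝒜) : ∀ n : ℕ, (I ^ n).IsHomogeneous 𝒜
  | 0 => by rw [pow_zero, Ideal.one_eq_top]; exact Ideal.IsHomogeneous.top 𝒜
  | n + 1 => by rw [pow_succ]; exact (isHomogeneous_pow hI n).mul hI

end Graded

/-! ### Homogeneous `𝔮`-primary ideals of exponent `e` in `ℚ[x₀, …, x_m]` -/

section Rx

open MvPolynomial

attribute [local instance] MvPolynomial.gradedAlgebra

variable {m : ℕ}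

/-- The exponent of an ideal sandwiched between `𝔮ᵉ` and `𝔮^{(e)}` (Noetherian domain, `𝔮 ≠ 0`
prime, `e ≥ 1`) is `e`. [folklore] -/
theorem primaryExponent_eq_of_pow_le_of_le_symbPow {𝔮 : Ideal (Rx m)} [h𝔮 : 𝔮.IsPrime]
    (h0 : 𝔮 ≠ ⊥) {e : ℕ} (he : 1 ≤ e) {q : Ideal (Rx m)} (hrad : q.radical = 𝔮)
    (h1 : 𝔮 ^ e ≤ q) (h2 : q ≤ symbPow 𝔮 e) : primaryExponent q = e := by
  unfold primaryExponent
  rw [hrad]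
  refine le_antisymm (Nat.sInf_le h1) (le_csInf ⟨e, h1⟩ fun k hk => ?_)
  by_contra hke
  have hke' : k ≤ e - 1 := by push Not at hke; omega
  exact not_pow_pred_le_symbPow h0 he ((Ideal.pow_le_pow_right hke').trans (hk.trans h2))

/-- **Homogeneous primary ideals of prescribed exponent.** For a non-zero homogeneous prime
`𝔮 ⊂ ℚ[x₀, …, x_m]` and `e ≥ 1` there is a homogeneous `𝔮`-primary ideal `q` with `𝔮ᵉ ≤ q ≤ 𝔮`
whose exponent (`primaryExponent`) is exactly `e` — the homogeneous core of the symbolic power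
`𝔮^{(e)}`; by Prop. 4.4 its associated form is `F_𝔮ᵉ`. [cite: NesterenkoPhilippon2001, Ch. 3
Prop. 4.4 (p. 38)] -/
theorem exists_homogeneous_primary_exponent_eq {𝔮 : Ideal (Rx m)} (h𝔮 : 𝔮.IsPrime)
    (h𝔮hom : 𝔮.IsHomogeneous (homogeneousSubmodule (Fin (m + 1)) ℚ)) (h0 : 𝔮 ≠ ⊥) {e : ℕ}
    (he : 1 ≤ e) :
    ∃ q : Ideal (Rx m), q.IsPrimary ∧ q.radical = 𝔮 ∧
      q.IsHomogeneous (homogeneousSubmodule (Fin (m + 1)) ℚ) ∧ 𝔮 ^ e ≤ q ∧ q ≤ 𝔮 ∧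
      primaryExponent q = e := by
  haveI := h𝔮
  set q : Ideal (Rx m) := ((symbPow 𝔮 e).homogeneousCore (homogeneousSubmodule (Fin (m + 1)) ℚ)).toIdeal
    with hq
  have hle : q ≤ symbPow 𝔮 e := Ideal.toIdeal_homogeneousCore_le _ _
  have hpow : 𝔮 ^ e ≤ q := by
    rw [hq, ← (isHomogeneous_pow h𝔮hom e).toIdeal_homogeneousCore_eq_self]
    exact Ideal.homogeneousCore_mono _ (pow_le_symbPow e)
  have hq𝔮 : q ≤ 𝔮 := hle.trans (symbPow_le he)
  have hrad : q.radical = 𝔮 := by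
    refine le_antisymm ((Ideal.radical_mono hq𝔮).trans h𝔮.radical.le) fun x hx => ?_
    exact ⟨e, hpow (Ideal.pow_mem_pow hx e)⟩
  exact ⟨q, isPrimary_homogeneousCore (isPrimary_symbPow he), hrad,
    ((symbPow 𝔮 e).homogeneousCore _).isHomogeneous, hpow, hq𝔮,
    primaryExponent_eq_of_pow_le_of_le_symbPow h0 he hrad hpow hle⟩

end Rx

end Nesterenko

end Literature.NumberTheory.Transcendental

end
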